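/-
Copyright: harness tree, Literature layer (sorry-free). b2b-lace enum2-g13 (ENUMERATION SHARD B gen 13),
GAPS G8 (δ2)(i) M3: the SEEDCERT kernel evaluator (computable layer).
-/
import Literature.Probability.LatticeModels.SRWHeatKernelBracketCoeffs
import Mathlib.Data.Nat.Factorial.DoubleFactorial
import HarnessLib

/-!
# SEEDCERT kernel evaluator, computable layer: walk counts, Poisson block, Bessel-tail brackets

This file is the COMPUTABLE half of the seed-certificate evaluator for the SRW integrals
`I_{n,0}(x; 11) = srwI 11 n 0 x` (Fitzner–van der Hofstad [NoBLE17, §5.1.1 (5.4)–(5.5)]: Bessel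
`u`-representation, split at `u = T`, Poissonised `[0,T]` block, large-`u` asymptotic bracket on `[T,∞)`).
Everything here is a `def` over `ℕ` / `ℤ` / `ℚ` lists meant to be evaluated by the KERNEL
(`decide +kernel`); the soundness theorem (`SrwSeedCertSound`) turns `Cert.check c = true` into
`c.lo n ≤ srwI 11 n 0 x ≤ c.hi n`.  Design notes (kernel cost): the walk-count layer is the
parity-halved exponential-generating-function ("hat") convolution `Ŵ_k = W_{2k+A} · M̂!/(2k+A)!`
(one Cauchy product + one exact division per coordinate; no binomials in the hot loop, no random
access, every row forced once through a `BEq` guard so later reads hit the kernel's whnf cache);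
the `[T,∞)` layer multiplies dyadically-scaled integer coefficient lists held as pairs of `ℕ` lists
(positive and negative parts), so that all hot-loop arithmetic is on kernel-accelerated `ℕ` literals.

* `convN` — truncated Cauchy product of `ℕ` coefficient lists; `convPN` — the signed product of an
  integer list with a polynomial held as a (positive part, negative part) pair of `ℕ` lists;
* `hatRow1`, `wHatFold` — the hat half-table of the binomial dimension recursion (`SrwCount.G`);
* `facSeq`, `expSeq` (`A_j = Σ_{i≤j} λ^i j!/i!`), `horner` — the exact
  numerators of `P_n = Σ_{m<M} C(m+n',n') p_m` and `U_n = Σ_{m<M} C(m+n',n') p_m E_{m+n'+1}(λ)`;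
* `expNegOneLo/Hi` — rational brackets of `e^{-1}` (32 terms of the Taylor series ± the Lagrange
  bound), `expPartialQ`;
* `mcoef a J i = bracketCoeffQ a J i · (2i-1)‼/4^i` — the main-term coefficients of
  `√(2πu) q_u(a)` in `w = 1/u`; `loList` (lower bracket polynomial), `epsBoundQ` (the rational
  majorant of the bracket constant `ε_a` with `√(2π) ≤ sHi`, `2/π ≤ 2/piLo`, `e^{-2Tσ} ≤ 1/E_N(2Tσ)`);
* `Cert` — the certificate data of one class (coordinates, `T = t²`, `J`, `s₀`, `K`, `M̂`, `M n`,
  `ε⁺_a`, scale `S`, `√(2π)` brackets, target intervals) and `Cert.check : Bool`.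

[cite: FitznerVanDerHofstad2016NoBLE, §5.1.1 (5.4)–(5.5) pp. 1089–1090]
-/

namespace Literature.Probability.FitznerVanDerHofstad2017.SeedCert

open Finset
open Literature.Probability.LatticeModels (bracketCoeffQ invSqrtCoeffQ)

/-! ### Coefficient-list kernels (monomorphic: a typeclass-generic version is an order of magnitude
slower in the kernel) -/

/-- First `n` entries of `c • v` (fewer if `v` is shorter), over `ℕ`. [folklore] -/
def mulRowN (c : ℕ) : List ℕ → ℕ → List ℕ
  | _, 0 => []
  | [], _ + 1 => []
  | x :: xs, n + 1 => (c * x) :: mulRowN c xs n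

/-- Entrywise sum over `ℕ`, the shorter list padded with `0`. [folklore] -/
def zipAddN : List ℕ → List ℕ → List ℕ
  | [], ys => ys
  | x :: xs, [] => x :: xs
  | x :: xs, y :: ys => (x + y) :: zipAddN xs ys

/-- The first `L` coefficients of the Cauchy product of two `ℕ` coefficient lists
(`(c :: us) * v = c • v + X · (us * v)`). [folklore] -/
def convN : List ℕ → List ℕ → ℕ → List ℕ
  | [], _, L => List.replicate L 0
  | _ :: _, _, 0 => []
  | c :: us, v, L + 1 =>
      match mulRowN c v (L + 1) with
      | [] => []
      | p :: ps => p :: zipAddN ps (convN us v L)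

/-- Sum of an `ℕ` list (accumulator form). [folklore] -/
def lsumNAux : List ℕ → ℕ → ℕ
  | [], acc => acc
  | x :: xs, acc => lsumNAux xs (acc + x)

/-- Sum of an `ℕ` list. [folklore] -/
def lsumN (l : List ℕ) : ℕ := lsumNAux l 0

/-- `forceN l = l`; in the kernel the `Nat.beq` test evaluates every entry of `l` once, so that later
reads of the (shared) entries hit the whnf cache instead of building deep thunk chains. [folklore] -/
def forceN (l : List ℕ) : List ℕ := bif Nat.beq (lsumN l) (lsumN l) then l else []

/-- `consAdd a rest` = the coefficient list of `a + X · rest`. [folklore] -/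
def consAdd : List ℕ → List ℕ → List ℕ
  | [], rest => 0 :: rest
  | p :: ps, rest => p :: zipAddN ps rest

/-- `c • v` over `ℕ`. [folklore] -/
def smulN (c : ℕ) : List ℕ → List ℕ
  | [] => []
  | x :: xs => (c * x) :: smulN c xs

/-- **Signed Cauchy product in positive/negative parts.** For an integer coefficient list `q` and a
pair `(pp, pn)` of `ℕ` lists representing the polynomial `pp - pn`, the (full) product
`q * (pp - pn)` as a pair `(rp, rn)` with value `rp - rn` (all hot-loop arithmetic on `ℕ` literals:
`Int` arithmetic is two orders of magnitude slower in the kernel). [folklore] -/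
def convPN : List ℤ → List ℕ → List ℕ → List ℕ × List ℕ
  | [], _, _ => ([], [])
  | c :: us, pp, pn =>
      let r := convPN us pp pn
      match c with
      | Int.ofNat k => (consAdd (smulN k pp) r.1, consAdd (smulN k pn) r.2)
      | Int.negSucc k => (consAdd (smulN (k + 1) pn) r.1, consAdd (smulN (k + 1) pp) r.2)

/-- `forcePN r = r` (see `forceN`): evaluates every entry of both lists once. [folklore] -/
def forcePN (r : List ℕ × List ℕ) : List ℕ × List ℕ :=
  bif Nat.beq (lsumN r.1 + lsumN r.2) (lsumN r.1 + lsumN r.2) then r else ([], [])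

/-! ### The walk-count layer (hat-form half-tables) -/

/-- `prodRangeAux n i acc = acc · (i+1)(i+2)⋯(i+n)`. [folklore] -/
def prodRangeAux : ℕ → ℕ → ℕ → ℕ
  | 0, _, acc => acc
  | n + 1, i, acc => prodRangeAux n (i + 1) (acc * (i + 1))

/-- `b! / a! = (a+1)(a+2)⋯b` for `a ≤ b`. [folklore] -/
def prodRange (a b : ℕ) : ℕ := prodRangeAux (b - a) a 1

/-- `hatRow1Aux a n k c = [c, c/((k+1)(k+1+a)), …]` (`n` entries, ratio recursion). [folklore] -/
def hatRow1Aux (a : ℕ) : ℕ → ℕ → ℕ → List ℕ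
  | 0, _, _ => []
  | n + 1, k, c => c :: hatRow1Aux a n (k + 1) (c / ((k + 1) * (k + 1 + a)))

/-- The hat row of ONE coordinate of absolute value `a`: `[M̂!/(k!(k+a)!) | k = 0..K]`, given
`Mf = M̂!` (exact as long as `2K + a ≤ M̂`). Entry `k` is `M̂! · walk1 (2k+a) a / (2k+a)!`. [folklore] -/
def hatRow1 (Mf a K : ℕ) : List ℕ := hatRow1Aux a (K + 1) 0 (Mf / prodRange 0 a)

/-- Entrywise exact division by `Mf`. [folklore] -/
def divRow (Mf : ℕ) : List ℕ → List ℕ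
  | [] => []
  | x :: xs => (x / Mf) :: divRow Mf xs

/-- One coordinate step of the hat recursion: `Ŵ' = (ĉ ⋆ Ŵ) / M̂!` (first `K+1` coefficients). [folklore] -/
def hatStep (Mf K : ℕ) (row : List ℕ) (b : ℕ) : List ℕ :=
  forceN (divRow Mf (convN (hatRow1 Mf b K) row (K + 1)))

/-- The hat table of zero coordinates: `[M̂!, 0, …, 0]` (`K+1` entries). [folklore] -/
def delta0 (Mf K : ℕ) : List ℕ := Mf :: List.replicate K 0

/-- `wHatFold Mf K coords` = the hat half-table after the coordinates `coords` (in the order of the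
binomial dimension recursion `SrwCount.G`): entry `k` = `M̂! · G x j (2k + A_j) / (2k + A_j)!`,
`A_j = Σ coords`. [folklore] -/
def wHatFold (Mf K : ℕ) (coords : List ℕ) : List ℕ := coords.foldl (hatStep Mf K) (delta0 Mf K)

/-! ### Integer sequences for the Poisson block -/

/-- `facSeqAux j f c = [f, f·(j+1)(j+2), …]` (`c` entries): with `f = j!` the list
`[j!, (j+2)!, (j+4)!, …]`. [folklore] -/
def facSeqAux : ℕ → ℕ → ℕ → List ℕ
  | _, _, 0 => []
  | j, f, c + 1 => f :: facSeqAux (j + 2) (f * ((j + 1) * (j + 2))) c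

/-- `[s!, (s+2)!, …, (s + 2(c-1))!]`. [folklore] -/
def facSeq (s c : ℕ) : List ℕ := facSeqAux s s.factorial c

/-- One step of `(j, A_j, λ^j) ↦ (j+1, A_{j+1}, λ^{j+1})` with `A_{j+1} = (j+1) A_j + λ^{j+1}`,
iterated: `expStepAux lam j a p s = (A_{j+s}, λ^{j+s})`. [folklore] -/
def expStepAux (lam : ℕ) : ℕ → ℕ → ℕ → ℕ → ℕ × ℕ
  | _, a, p, 0 => (a, p)
  | j, a, p, s + 1 => expStepAux lam (j + 1) ((j + 1) * a + p * lam) (p * lam) s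

/-- `expSeqAux lam j A_j λ^j c = [A_j, A_{j+2}, …]` (`c` entries), where
`A_j = Σ_{i ≤ j} λ^i j!/i! = j! · e^λ_{≤ j}`-numerator (`E_{j+1}(λ) = e^{-λ} A_j / j!`). [folklore] -/
def expSeqAux (lam : ℕ) : ℕ → ℕ → ℕ → ℕ → List ℕ
  | _, _, _, 0 => []
  | j, a, p, c + 1 =>
      let r := expStepAux lam j a p 2
      a :: expSeqAux lam (j + 2) r.1 r.2 c

/-- `[A_s, A_{s+2}, …]` (`c` entries). [folklore] -/
def expSeq (lam s c : ℕ) : List ℕ :=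
  let r := expStepAux lam 0 1 1 s
  expSeqAux lam s r.1 r.2 c

/-- Horner accumulation `acc ↦ acc · 484 + w_k f_k` along two lists (stops at the shorter):
`hornerAux [w₀,…] [f₀,…,f_{c-1}] 0 = Σ_{k<c} w_k f_k 484^{c-1-k}`. Structural in both lists — no
random access (random `List.getD` access into long tables allocates a fresh spine walk per lookup
and exhausts the kernel's memory budget). [folklore] -/
def hornerAux : List ℕ → List ℕ → ℕ → ℕ
  | w :: ws, f :: fs, acc => hornerAux ws fs (acc * 484 + w * f)
  | _, _, acc => acc

/-- See `hornerAux`. [folklore] -/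
def horner (w f : List ℕ) : ℕ := hornerAux w f 0


/-! ### Rational constants -/

/-- `Σ_{i<N} (-1)^i/i!` as an exact rational. [folklore] -/
def expNegOnePartial (N : ℕ) : ℚ := ∑ i ∈ range N, (-1 : ℚ) ^ i / (i.factorial : ℚ)

/-- The Lagrange bound `(N+1)/(N!·N)` of `|e^{-1} - Σ_{i<N} (-1)^i/i!|` (`Real.exp_bound`). [folklore] -/
def expNegOneErr (N : ℕ) : ℚ := ((N : ℚ) + 1) / ((N.factorial : ℚ) * N)

/-- Lower rational bracket of `e^{-1}` (32 Taylor terms). [folklore] -/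
def expNegOneLo : ℚ := expNegOnePartial 32 - expNegOneErr 32

/-- Upper rational bracket of `e^{-1}` (32 Taylor terms). [folklore] -/
def expNegOneHi : ℚ := expNegOnePartial 32 + expNegOneErr 32

/-- `E_N(y) = Σ_{i<N} y^i/i!` as an exact rational. [folklore] -/
def expPartialQ (y : ℚ) (N : ℕ) : ℚ := ∑ i ∈ range N, y ^ i / (i.factorial : ℚ)

/-- `3.14159265358979323846 < π` (`Real.pi_gt_d20`). [folklore] -/
def piLo : ℚ := 314159265358979323846 / 100000000000000000000

/-- `π < 3.14159265358979323847` (`Real.pi_lt_d20`). [folklore] -/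
def piHi : ℚ := 314159265358979323847 / 100000000000000000000

/-- `complSum i σ r = Σ_{j ≤ i} C(i,j) j! σ^{i-j}/r^{j+1}` over `ℚ` (the tree's `complSum` is over `ℝ`). [folklore] -/
def complSumQ (i : ℕ) (σ r : ℚ) : ℚ :=
  ∑ j ∈ range (i + 1), (i.choose j : ℚ) * (j.factorial : ℚ) * σ ^ (i - j) / r ^ (j + 1)

/-! ### The `[T,∞)` layer: bracket coefficient lists -/

/-- Main-term coefficient of `w^i` (`w = 1/u`) in the bracket of `√(2πu) q_u(a)`:
`bracketCoeffQ a J i · (2i-1)‼ / 4^i`. [folklore] -/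
def mcoef (a J i : ℕ) : ℚ := bracketCoeffQ a J i * ((2 * i - 1).doubleFactorial : ℚ) / 4 ^ i

/-- Number of coefficients of the bracket polynomial of a coordinate of absolute value `a`
(`a + J + 1`, at least `J + 2` so that the `ε w^{J+1}` term has a slot). [folklore] -/
def blen (a J : ℕ) : ℕ := max (a + J + 1) (J + 2)

/-- The LOWER bracket polynomial of `√(2πu) q_u(a)` in `w = 1/u` as a coefficient list:
`Σ_i mcoef a J i w^i - ε w^{J+1}`. [folklore] -/
def loList (a J : ℕ) (eps : ℚ) : List ℚ :=
  (List.range (blen a J)).map fun i => mcoef a J i - if i = J + 1 then eps else 0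

/-- `ν_a = mcoef_0 - Σ_{i ≥ 1} max(0, -lo_i) h^i`: a lower bound of the lower bracket polynomial on
`w ∈ [0, h]`; the certificate checks `0 ≤ ν_a`. [folklore] -/
def loFloor (a J : ℕ) (eps h : ℚ) : ℚ :=
  mcoef a J 0 - ∑ i ∈ range (blen a J), if i = 0 then 0 else max 0 (-((loList a J eps).getD i 0)) * h ^ i

/-- The rational majorant of the bracket constant `ε_a(J, s₀, T)` of
`LatticeModels.srwHeatKernel_bracket_eps_coeffQ`, with `√(2π) ≤ sHi`, `2/π ≤ 2/piLo`,
`e^{-2Ts₀²} ≤ 1/E_N(2Ts₀²)` and `T^{J+3/2} = T^{J+1}·t` for `T = t²`. [folklore] -/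
def epsBoundQ (a J : ℕ) (s0 : ℚ) (t : ℕ) (sHi : ℚ) (N : ℕ) : ℚ :=
  invSqrtCoeffQ (J + 1) / (1 - s0 ^ 2) * ((2 * J + 1).doubleFactorial : ℚ) / 4 ^ (J + 1) +
    sHi * (1 / expPartialQ (2 * (t : ℚ) ^ 2 * s0 ^ 2) N) * ((t : ℚ) ^ 2) ^ (J + 1) * t *
      (1 + 2 / piLo * ∑ i ∈ range (a + J + 1),
        |bracketCoeffQ a J i| * (1 / (2 * s0) * complSumQ i (s0 ^ 2) (2 * (t : ℚ) ^ 2)))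

/-- Scaled integer coefficient: the numerator of `q · 2^S` (meaningful when that is an integer,
which `Cert.check` verifies). [folklore] -/
def scaleZ (S : ℕ) (q : ℚ) : ℤ := (q * 2 ^ S).num

/-- `true` iff `q · 2^S` is an integer. [folklore] -/
def dyadicOK (S : ℕ) (q : ℚ) : Bool := (q * 2 ^ S).den == 1

/-- The lower bracket polynomial as a `2^S`-scaled integer coefficient list. [folklore] -/
def loListZ (a J : ℕ) (eps : ℚ) (S : ℕ) : List ℤ := (loList a J eps).map (scaleZ S)

/-- The UPPER bracket polynomial of `√(2πu) q_u(a)` in `w = 1/u` as a coefficient list: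
`Σ_i mcoef a J i w^i + ε w^{J+1}`. [folklore] -/
def upList (a J : ℕ) (eps : ℚ) : List ℚ :=
  (List.range (blen a J)).map fun i => mcoef a J i + if i = J + 1 then eps else 0

/-- The upper bracket polynomial as a `2^S`-scaled integer coefficient list. [folklore] -/
def upListZ (a J : ℕ) (eps : ℚ) (S : ℕ) : List ℤ := (upList a J eps).map (scaleZ S)

/-- Product of the scaled lower bracket polynomials of a list of coordinate values, as a pair of
`ℕ` coefficient lists `(pos, neg)` with value `pos - neg` (full Cauchy products; scale `2^{S·length}`). [folklore] -/
def loProdPN (J : ℕ) (eps : ℕ → ℚ) (S : ℕ) : List ℕ → List ℕ × List ℕ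
  | [] => ([1], [0])
  | a :: as =>
      let p := loProdPN J eps S as
      forcePN (convPN (loListZ a J (eps a) S) p.1 p.2)

/-- Product of the scaled UPPER bracket polynomials (as `loProdPN`). [folklore] -/
def upProdPN (J : ℕ) (eps : ℕ → ℚ) (S : ℕ) : List ℕ → List ℕ × List ℕ
  | [] => ([1], [0])
  | a :: as =>
      let p := upProdPN J eps S as
      forcePN (convPN (upListZ a J (eps a) S) p.1 p.2)

/-- `Σ_i (pos_i - neg_i) · 2/((2i + e₀) · t^{2i + e₀})` for a signed coefficient list in
positive/negative parts (`e₀ = 11 - 2n`): the termwise integral `∫_T^∞ u^{n-1-11/2} Σ_i z_i u^{-i} du`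
for `T = t²`, up to the scale. [folklore] -/
def tailIntAux (t : ℕ) : List ℕ → List ℕ → ℕ → ℚ → ℚ
  | [], _, _, acc => acc
  | _ :: _, [], _, acc => acc
  | p :: ps, q :: qs, e, acc =>
      tailIntAux t ps qs (e + 2) (acc + ((p : ℚ) - (q : ℚ)) * 2 / ((e : ℚ) * (t : ℚ) ^ e))

/-- See `tailIntAux`. [folklore] -/
def tailInt (t : ℕ) (pn : List ℕ × List ℕ) (e₀ : ℕ) : ℚ := tailIntAux t pn.1 pn.2 e₀ 0

/-! ### Certificates -/

/-- The data of a seed certificate for one class `x ∈ ℤ^{11}` (`x_i = coords[i]`, zero beyond):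
cut-off `T = t²`, bracket order `J`, cut point `s₀`, half-table length `K+1`, hat base `Mh = 2K + A`,
Poisson truncation `M n` per seed index `n = 1..4`, bracket-constant majorants `eps a`, dyadic scale
`S`, `expPartial` length `nexp`, brackets `sLo ≤ √(2π) ≤ sHi`, the target intervals `[lo n, hi n]`,
and the INTERMEDIATE brackets `pLo n ≤ P_n ≤ pHi n`, `uLo n ≤ U_n ≤ uHi n`, `ilLo n ≤ IL_n`,
`IU_n ≤ iuHi n` (short rationals chosen by the generator; they let the kernel verify the walk-count
layer, the tail layer and the final inequality in three separate declarations, each within the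
kernel's memory budget). [folklore] -/
structure Cert where
  coords : List ℕ
  t : ℕ
  J : ℕ
  s0 : ℚ
  K : ℕ
  Mh : ℕ
  M : ℕ → ℕ
  eps : ℕ → ℚ
  S : ℕ
  nexp : ℕ
  sLo : ℚ
  sHi : ℚ
  lo : ℕ → ℚ
  hi : ℕ → ℚ
  pLo : ℕ → ℚ
  pHi : ℕ → ℚ
  uLo : ℕ → ℚ
  uHi : ℕ → ℚ
  ilLo : ℕ → ℚ
  iuHi : ℕ → ℚ

namespace Cert

variable (c : Cert)

/-- `A = Σ_i |x_i|`. [folklore] -/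
def A : ℕ := c.coords.sum

/-- `λ = d·T = 11 t²`. [folklore] -/
def lam : ℕ := 11 * c.t ^ 2

/-- The full list of the eleven coordinate absolute values (`coords` padded with zeros). [folklore] -/
def avals : List ℕ := c.coords ++ List.replicate (11 - c.coords.length) 0

/-- The hat half-table `[Ŵ_0, …, Ŵ_K]`, `Ŵ_k = M̂! · W_{2k+A}(x; 11)/(2k+A)!`. [folklore] -/
def what : List ℕ := wHatFold (prodRange 0 c.Mh) c.K c.avals

/-- Number of half-indices `k` with `2k + A < M n`. [folklore] -/
def cnt (n : ℕ) : ℕ := (c.M n + 1 - c.A) / 2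

/-- The common denominator `n'! · M̂! · 22^{M̂}` of `P_n` and `U_n` (`n' = n - 1`). [folklore] -/
def den (n : ℕ) : ℚ := ((n - 1).factorial : ℚ) * (prodRange 0 c.Mh : ℚ) * (22 : ℚ) ^ c.Mh

/-- Numerator of `P_n`: `Σ_{k < cnt n} ŵ_k (A+2k+n')! 22^{M̂-A-2k} = 484^{K+1-cnt n} · horner`. [folklore] -/
def NP (w : List ℕ) (n : ℕ) : ℕ := 484 ^ (c.K + 1 - c.cnt n) * horner w (facSeq (c.A + (n - 1)) (c.cnt n))

/-- Numerator of `U_n`: `Σ_{k < cnt n} ŵ_k A_{A+2k+n'} 22^{M̂-A-2k} = 484^{K+1-cnt n} · horner`. [folklore] -/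
def NU (w : List ℕ) (n : ℕ) : ℕ := 484 ^ (c.K + 1 - c.cnt n) * horner w (expSeq c.lam (c.A + (n - 1)) (c.cnt n))

/-- `P_n = Σ_{m < M n} C(m+n', n') p_m(x; 11)`, exactly (`w` = the hat half-table). [folklore] -/
def Pq (w : List ℕ) (n : ℕ) : ℚ := (c.NP w n : ℚ) / c.den n

/-- `U_n = Σ_{m < M n} C(m+n', n') p_m(x; 11) · (m+n')! e^λ_{≤ m+n'} / (m+n')!`-type sum, exactly:
`U_n = Σ_{m<M n} C(m+n',n') p_m A_{m+n'}/(m+n')!`, so that `e^{-λ} U_n = Σ C(m+n',n') p_m E_{m+n'+1}(λ)`. [folklore] -/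
def Uq (w : List ℕ) (n : ℕ) : ℚ := (c.NU w n : ℚ) / c.den n

/-- `r⁻ = expNegOneLo^λ ≤ e^{-λ}`. [folklore] -/
def rLo : ℚ := expNegOneLo ^ c.lam

/-- `e^{-λ} ≤ r⁺ = expNegOneHi^λ`. [folklore] -/
def rHi : ℚ := expNegOneHi ^ c.lam

/-- The majorant `R⁺_n` of the Poisson-tail remainder `Σ_{m ≥ M} C(m+n',n') p_m Q(λ, m+n'+1)`:
`r⁺ · θ · θ' · λ^{M+n'+1} / (n'! · M! · (M+n'+1))`, `θ = (M+n'+2)/(M+n'+2-λ)`, `θ' = (M+1)/(M+1-λ)`. [folklore] -/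
def Rplus (n : ℕ) : ℚ :=
  c.rHi * (((c.M n + n + 1 : ℕ) : ℚ) / (((c.M n + n + 1 : ℕ) : ℚ) - (c.lam : ℚ))) *
    (((c.M n + 1 : ℕ) : ℚ) / (((c.M n + 1 : ℕ) : ℚ) - (c.lam : ℚ))) *
    (c.lam : ℚ) ^ (c.M n + n) / (((n - 1).factorial : ℚ) * ((c.M n).factorial : ℚ) * ((c.M n + n : ℕ) : ℚ))

/-- `κ⁻ = 1/((2 piHi)^5 · sHi) ≤ (2π)^{-11/2}`. [folklore] -/
def kLo : ℚ := 1 / ((2 * piHi) ^ 5 * c.sHi)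

/-- `(2π)^{-11/2} ≤ κ⁺ = 1/((2 piLo)^5 · sLo)`. [folklore] -/
def kHi : ℚ := 1 / ((2 * piLo) ^ 5 * c.sLo)

/-- `h = 1/T`. [folklore] -/
def h : ℚ := 1 / (c.t : ℚ) ^ 2

/-- The scaled product `PL` of the eleven lower bracket polynomials (positive/negative parts). [folklore] -/
def plPN : List ℕ × List ℕ := loProdPN c.J c.eps c.S c.avals

/-- The scaled product of the eleven UPPER bracket polynomials. [folklore] -/
def puPN : List ℕ × List ℕ := upProdPN c.J c.eps c.S c.avals

/-- The scale `2^{11 S}` of the products. [folklore] -/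
def scale : ℚ := (2 : ℚ) ^ (11 * c.S)

/-- `∫_T^∞ u^{n-1-11/2} P(1/u) du` for a scaled product `pl` with value `P · 2^{11S}` (exact):
with `pl = plPN` this is `IL_n`, with `pl = puPN` it is `IU_n`. [folklore] -/
def tailOf (pl : List ℕ × List ℕ) (n : ℕ) : ℚ := tailInt c.t pl (11 - 2 * n) / c.scale

/-- `IL_n = ∫_T^∞ u^{n-1-11/2} PL(1/u) du`. [folklore] -/
def IL (n : ℕ) : ℚ := c.tailOf c.plPN n

/-- `IU_n = ∫_T^∞ u^{n-1-11/2} PU(1/u) du`. [folklore] -/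
def IU (n : ℕ) : ℚ := c.tailOf c.puPN n

/-- `c_n = 11^n/(n-1)!`, the prefactor of the `u`-representation of `srwI 11 n 0`. [folklore] -/
def pref (n : ℕ) : ℚ := (11 : ℚ) ^ n / ((n - 1).factorial : ℚ)

/-- The certified LOWER bound of `srwI 11 n 0 x`, assembled from the intermediate brackets. [folklore] -/
def loFinal (n : ℕ) : ℚ := c.pLo n - c.rHi * c.uHi n + pref n * c.kLo * c.ilLo n

/-- The certified UPPER bound of `srwI 11 n 0 x`, assembled from the intermediate brackets. [folklore] -/
def hiFinal (n : ℕ) : ℚ := c.pHi n - c.rLo * c.uLo n + c.Rplus n + pref n * c.kHi * c.iuHi n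

/-- Parameter sanity: `0 < s₀ < 1`, `(J + 3/2)/(2 s₀²) ≤ T`, `0 < t`, `M̂ = 2K + A`, at most eleven
listed coordinates, `√(2π)` brackets, and for every coordinate value the bracket constant, the
positivity floor and the dyadic integrality of the scaled coefficients; per seed index
`1 ≤ M n ≤ M̂ + 1` and `λ + 1 < M n`. (Kernel cost: seconds.) [folklore] -/
def paramsOK : Bool :=
  decide (0 < c.s0) && decide (c.s0 < 1) && decide (((c.J : ℚ) + 3 / 2) / (2 * c.s0 ^ 2) ≤ (c.t : ℚ) ^ 2) &&
  decide (0 < c.t) && (c.Mh == 2 * c.K + c.A) && decide (c.coords.length ≤ 11) && decide (0 < c.nexp) &&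
  decide (0 < c.sLo) && decide (c.sLo ^ 2 ≤ 2 * piLo) && decide (0 < c.sHi) && decide (2 * piHi ≤ c.sHi ^ 2) &&
  decide (0 ≤ expNegOneLo) &&
  c.avals.all (fun a =>
    decide (0 ≤ c.eps a) &&
    decide (epsBoundQ a c.J c.s0 c.t c.sHi c.nexp ≤ c.eps a) &&
    decide (0 ≤ loFloor a c.J (c.eps a) c.h) &&
    (loList a c.J (c.eps a)).all (dyadicOK c.S) && (upList a c.J (c.eps a)).all (dyadicOK c.S)) &&
  (List.range 4).all (fun i =>
    decide (1 ≤ c.M (i + 1)) && decide (c.M (i + 1) ≤ c.Mh + 1) && decide (c.cnt (i + 1) ≤ c.K + 1) &&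
    decide (c.lam + 1 < c.M (i + 1)))

/-- **Walk-count layer check**: the exact `P_n`, `U_n` (computed from the kernel-evaluated hat table)
lie in the generator's brackets `[pLo n, pHi n]`, `[uLo n, uHi n]`. (Kernel cost: the hat table.) [folklore] -/
def poissonCheck : Bool :=
  let w := c.what
  (List.range 4).all fun i =>
    decide (c.pLo (i + 1) ≤ c.Pq w (i + 1)) && decide (c.Pq w (i + 1) ≤ c.pHi (i + 1)) &&
    decide (c.uLo (i + 1) ≤ c.Uq w (i + 1)) && decide (c.Uq w (i + 1) ≤ c.uHi (i + 1))

/-- **Tail layer check**: `ilLo n ≤ IL_n` and `IU_n ≤ iuHi n` for the kernel-evaluated product of the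
eleven bracket polynomials. (Kernel cost: the product.) [folklore] -/
def tailCheck : Bool :=
  let pl := c.plPN
  let pu := c.puPN
  (List.range 4).all fun i =>
    decide (c.ilLo (i + 1) ≤ c.tailOf pl (i + 1)) && decide (c.tailOf pu (i + 1) ≤ c.iuHi (i + 1))

/-- **Final check**: `0 ≤ uLo n`, `0 ≤ ilLo n`, and the assembled bounds sit inside the target
interval: `lo n ≤ loFinal n`, `hiFinal n ≤ hi n`. (Kernel cost: seconds.) [folklore] -/
def finalCheck : Bool :=
  (List.range 4).all fun i =>
    decide (0 ≤ c.uLo (i + 1)) && decide (0 ≤ c.ilLo (i + 1)) &&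
    decide (c.lo (i + 1) ≤ c.loFinal (i + 1)) && decide (c.hiFinal (i + 1) ≤ c.hi (i + 1))

/-- **The certificate check** (the conjunction; a class file proves the four conjuncts as separate
`decide +kernel` theorems). [folklore] -/
def check : Bool := c.paramsOK && c.finalCheck && c.poissonCheck && c.tailCheck

end Cert

end Literature.Probability.FitznerVanDerHofstad2017.SeedCert
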